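import Summits.RiemannHypothesis.RiemannHypothesis.Theorems.WeilWindowFlowWindowLipschitzStubCommutatorBoundAux2

/-!
# Toolkit III for stub `stub_commutatorBound` (E) of line `cut-dont-squeeze`, crux `WeilWindowFlow.WindowLipschitz`
(item stmt-RiemannHypothesis-1039)

The far-field potential, and the remaining (soft) terms of the localisation error for a window
function `u` cut by an admissible cutoff `χ` of width `h`, all controlled by the layer mass
`∫_{a−|x|<2h} |u|`:

* `stub_commutatorBound_integral_V_le`: the FAR-FIELD POTENTIAL `V = |u| · W`,
  `W(x) = ρ(4h)` at depth `a − |x| < 4h` and `ρ((a − |x|)/2)` beyond, has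
  `‖V‖₁ ≤ (1 + K) + 8(1+K)√J + ρ(d₀/8)‖u‖₁` (`2^{J+2} h ≤ d₀ < 2^{J+3} h`; dyadic shells) — the
  `(log(1/h))^{+1/2}` half of the cancellation;
* `stub_commutatorBound_prime_le`: a prime jump `∫ (χ(x+s) − χ(x))² |u(x+s)| |u(x)| dx ≤ 2 K_A ∫ f`
  (one end lies in the layer, the other is bounded by the sup bound `|u| ≤ K_A`);
* `stub_commutatorBound_pole_le`, `stub_commutatorBound_pairing_le`: the pole pairings
  `|∫ θ u w| ≤ cosh(A/2) ∫ f` (`θ = 1 − χ, (1 − χ)²` vanish at depth `≥ 2h`) and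
  `|∫ u w| ≤ cosh(A/2) ‖u‖₁` for `w = cosh(·/2), sinh(·/2)`;
* `stub_commutatorBound_mass_ge`: `∫ |χ u|² ≥ ∫ |u|² − ∫_{a−|x|<2h} |u|²`;
* `stub_commutatorBound_layer_le`: the layer mass `∫_{a−|x|<2h}|u| ≤ 2(1+K) h/√J` under the
  edge-mass law (`2^J ≤ 1/(2h)`) — the `(log(1/h))^{-1/2}` half of the cancellation.

Sources: line card `Lines/cut-dont-squeeze.md` §Stub E; Cycon–Froese–Kirsch–Simon, *Schrödinger
Operators*, Thm. 3.2 (IMS localisation formula).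
-/

set_option linter.dupNamespace false

noncomputable section

open MeasureTheory Set Filter
open scoped Topology ENNReal NNReal

namespace Summit.RiemannHypothesis.RiemannHypothesis.Theorems.WeilWindowFlowWindowLipschitz

open Literature.NumberTheory.LFunctions

/-! ## The far-field potential -/

/-- **`L¹` bound of the far-field potential.** With `W(x) = ρ(4h)` for `a − |x| < 4h` and
`W(x) = ρ((a − |x|)/2)` otherwise, `V = |u| W` is integrable and
`∫ V ≤ (1 + K) + 8 (1 + K) √J + ρ(d₀/8) ∫ |u|` when `2^{J+2} h ≤ d₀ < 2^{J+3} h`: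
the layer `a − |x| < 4h` gives `ρ(4h) ∫_{layer} |u| ≤ (1/(4h)) (4 + 2K) h`, the dyadic region
`4h ≤ a − |x| < 2^{J+1} h` gives `8(1+K)√J` (`stub_commutatorBound_dyadic`), and deeper
`ρ((a−|x|)/2) ≤ ρ(d₀/8)`. -/
theorem stub_commutatorBound_integral_V_le {u : ℝ → ℂ} {a d₀ K h : ℝ} (hum : Measurable u)
    (hui : Integrable u) (hu2 : Integrable fun x ↦ ‖u x‖ ^ 2) (hK : 0 ≤ K) (hd₀ : 0 < d₀)
    (hd₁ : d₀ ≤ 1 / 4)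
    (hB : ∀ r, 0 < r → r ≤ d₀ → ∫ x in {x | a - r < |x|}, ‖u x‖ ^ 2 ≤ K * r / Real.log (1 / r))
    (hu0 : ∀ x, x ∉ Icc (-a) a → u x = 0) (hh : 0 < h) (J : ℕ) (hJ : 2 ^ (J + 2) * h ≤ d₀)
    (hJ' : d₀ < 2 ^ (J + 3) * h) :
    Integrable (fun x ↦ ‖u x‖ *
        (if a - |x| < 4 * h then weilArchDensity (4 * h) else weilArchDensity ((a - |x|) / 2))) ∧
      ∫ x, ‖u x‖ *
          (if a - |x| < 4 * h then weilArchDensity (4 * h) else weilArchDensity ((a - |x|) / 2)) ≤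
        (1 + K) + 8 * (1 + K) * Real.sqrt J + weilArchDensity (d₀ / 8) * ∫ x, ‖u x‖ := by
  have h4d : 4 * h ≤ d₀ := le_trans (by
    have : (4 : ℝ) ≤ 2 ^ (J + 2) := by
      calc (4 : ℝ) = 2 ^ 2 := by norm_num
        _ ≤ 2 ^ (J + 2) := pow_le_pow_right₀ (by norm_num) (by omega)
    nlinarith) hJ
  have h41 : 4 * h ≤ 1 := by linarith
  set D := (2 : ℝ) ^ (J + 1) * h with hD
  have hDpos : 0 < D := by positivity
  have hD8 : d₀ / 8 < D / 2 := by
    rw [hD]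
    have : (2 : ℝ) ^ (J + 3) * h = 2 ^ (J + 1) * h * 4 := by ring
    nlinarith
  set R := {x : ℝ | a - D < |x| ∧ |x| ≤ a - 4 * h} with hR
  set L4 := {x : ℝ | a - 4 * h < |x|} with hL4
  have hRm : MeasurableSet R := stub_commutatorBound_measurableSet_shell a _ _
  have hL4m : MeasurableSet L4 := stub_commutatorBound_measurableSet_layer a _
  set ρ4 := weilArchDensity (4 * h) with hρ4
  set ρ8 := weilArchDensity (d₀ / 8) with hρ8
  have hρ4pos : 0 < ρ4 := weilArchDensity_pos (by positivity)
  have hρ8pos : 0 < ρ8 := weilArchDensity_pos (by positivity)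
  -- the majorant `G = ρ4 |u| 1_{L4} + Φ 1_R + ρ8 |u|`
  have hRint : IntegrableOn (fun x ↦ ‖u x‖ * weilArchDensity ((a - |x|) / 2)) R :=
    stub_commutatorBound_integrableOn_phi hum hui (by positivity : 0 < 4 * h) hRm (fun x hx ↦ hx.2)
  have hGi : Integrable (fun x ↦ ρ4 * L4.indicator (fun x ↦ ‖u x‖) x +
      R.indicator (fun x ↦ ‖u x‖ * weilArchDensity ((a - |x|) / 2)) x + ρ8 * ‖u x‖) :=
    (((hui.norm.indicator hL4m).const_mul ρ4).add (hRint.integrable_indicator hRm)).add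
      (hui.norm.const_mul ρ8)
  have hWm : Measurable fun x : ℝ ↦
      (if a - |x| < 4 * h then weilArchDensity (4 * h) else weilArchDensity ((a - |x|) / 2)) :=
    Measurable.ite (measurableSet_lt (measurable_const.sub continuous_abs.measurable)
      measurable_const) measurable_const (measurable_weilArchDensity.comp
        ((measurable_const.sub continuous_abs.measurable).div_const 2))
  have hVm : Measurable fun x : ℝ ↦ ‖u x‖ *
      (if a - |x| < 4 * h then weilArchDensity (4 * h) else weilArchDensity ((a - |x|) / 2)) :=
    hum.norm.mul hWm
  -- pointwise comparison
  have hW0 : ∀ x, 0 ≤ (if a - |x| < 4 * h then weilArchDensity (4 * h)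
      else weilArchDensity ((a - |x|) / 2)) := fun x ↦ by
    split_ifs with hx
    · exact hρ4pos.le
    · exact (weilArchDensity_pos (by linarith [not_lt.1 hx])).le
  have hVG : ∀ x, ‖u x‖ * (if a - |x| < 4 * h then weilArchDensity (4 * h)
      else weilArchDensity ((a - |x|) / 2)) ≤ ρ4 * L4.indicator (fun x ↦ ‖u x‖) x +
      R.indicator (fun x ↦ ‖u x‖ * weilArchDensity ((a - |x|) / 2)) x + ρ8 * ‖u x‖ := by
    intro x
    have hG1 : 0 ≤ ρ4 * L4.indicator (fun x ↦ ‖u x‖) x :=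
      mul_nonneg hρ4pos.le (indicator_nonneg (fun _ _ ↦ norm_nonneg _) x)
    have hG2 : 0 ≤ R.indicator (fun x ↦ ‖u x‖ * weilArchDensity ((a - |x|) / 2)) x := by
      refine indicator_nonneg (fun y hy ↦ ?_) x
      exact mul_nonneg (norm_nonneg _) (weilArchDensity_pos (by have := hy.2; linarith)).le
    have hG3 : 0 ≤ ρ8 * ‖u x‖ := mul_nonneg hρ8pos.le (norm_nonneg _)
    split_ifs with hx
    · have hxL : x ∈ L4 := by show a - 4 * h < |x|; linarith
      rw [indicator_of_mem hxL]
      linarith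
    · rcases lt_or_ge (a - D) |x| with hxR | hxR
      · have hxR' : x ∈ R := ⟨hxR, by linarith [not_lt.1 hx]⟩
        simp only [indicator_of_mem hxR']
        linarith
      · have hdeep : weilArchDensity ((a - |x|) / 2) ≤ ρ8 :=
          weilArchDensity_antitoneOn (mem_Ioi.2 (by positivity)) (mem_Ioi.2 (by linarith))
            (by linarith)
        have := mul_le_mul_of_nonneg_left hdeep (norm_nonneg (u x))
        linarith
  have hVi : Integrable (fun x ↦ ‖u x‖ *
      (if a - |x| < 4 * h then weilArchDensity (4 * h) else weilArchDensity ((a - |x|) / 2))) :=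
    hGi.mono' hVm.aestronglyMeasurable (Eventually.of_forall fun x ↦ by
      rw [Real.norm_of_nonneg (mul_nonneg (norm_nonneg _) (hW0 x))]
      exact hVG x)
  refine ⟨hVi, ?_⟩
  -- the three pieces
  have hlayer : ∫ x in L4, ‖u x‖ ≤ (4 + 2 * K) * h := by
    have hT := stub_commutatorBound_setIntegral_norm_le (u := u) hL4m
      (stub_commutatorBound_measurableSet_shell a 0 (4 * h))
      (stub_commutatorBound_volume_shell_ne_top a 0 (4 * h)) (fun x hx hux ↦ ?_) hu2.integrableOn
      one_pos
    · have hvol := stub_commutatorBound_volume_real_shell_le a 0 (4 * h)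
      simp only [sub_zero] at hvol hT
      rw [max_eq_left (by positivity)] at hvol
      have hm : ∫ x in L4, ‖u x‖ ^ 2 ≤ 4 * K * h := by
        have hl4 : 1 ≤ Real.log (1 / (4 * h)) := by
          have hq : Real.exp 1 ≤ 1 / (4 * h) := by
            rw [le_div_iff₀ (by positivity)]
            have := Real.exp_one_lt_d9
            nlinarith
          simpa using Real.log_le_log (Real.exp_pos 1) hq
        calc ∫ x in L4, ‖u x‖ ^ 2 ≤ K * (4 * h) / Real.log (1 / (4 * h)) := hB _ (by positivity) h4d
          _ ≤ K * (4 * h) / 1 := div_le_div_of_nonneg_left (by positivity) one_pos hl4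
          _ = 4 * K * h := by ring
      calc ∫ x in L4, ‖u x‖ ≤ (1 * volume.real {x : ℝ | a - 4 * h < |x| ∧ |x| ≤ a} +
            (∫ x in L4, ‖u x‖ ^ 2) / 1) / 2 := hT
        _ ≤ (1 * (2 * (4 * h)) + (4 * K * h) / 1) / 2 := by gcongr
        _ = (4 + 2 * K) * h := by ring
    · have hxI : x ∈ Icc (-a) a := by
        by_contra hc
        exact hux (hu0 x hc)
      exact ⟨hx, by rw [sub_zero]; exact abs_le.2 ⟨hxI.1, hxI.2⟩⟩
  have hρ4le : ρ4 ≤ 1 / (4 * h) := stub_commutatorBound_rho_le_inv (by positivity) h41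
  have hdy := stub_commutatorBound_dyadic hum hui hu2 hK hd₁ hB J hh hJ
  have hL4nn : 0 ≤ ∫ x in L4, ‖u x‖ := integral_nonneg fun x ↦ norm_nonneg _
  calc ∫ x, ‖u x‖ * (if a - |x| < 4 * h then weilArchDensity (4 * h)
          else weilArchDensity ((a - |x|) / 2))
      ≤ ∫ x, (ρ4 * L4.indicator (fun x ↦ ‖u x‖) x +
          R.indicator (fun x ↦ ‖u x‖ * weilArchDensity ((a - |x|) / 2)) x + ρ8 * ‖u x‖) :=
        integral_mono hVi hGi hVG
    _ = ρ4 * (∫ x in L4, ‖u x‖) + (∫ x in R, ‖u x‖ * weilArchDensity ((a - |x|) / 2)) +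
          ρ8 * ∫ x, ‖u x‖ := by
        have hA : Integrable (fun x ↦ ρ4 * L4.indicator (fun x ↦ ‖u x‖) x) :=
          (hui.norm.indicator hL4m).const_mul ρ4
        have hBf : Integrable (fun x ↦
            R.indicator (fun x ↦ ‖u x‖ * weilArchDensity ((a - |x|) / 2)) x) :=
          hRint.integrable_indicator hRm
        have hC : Integrable (fun x ↦ ρ8 * ‖u x‖) := hui.norm.const_mul ρ8
        have hAB : Integrable (fun x ↦ ρ4 * L4.indicator (fun x ↦ ‖u x‖) x +
            R.indicator (fun x ↦ ‖u x‖ * weilArchDensity ((a - |x|) / 2)) x) := hA.add hBf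
        rw [integral_add hAB hC, integral_add hA hBf, integral_const_mul, integral_const_mul,
          integral_indicator hL4m, integral_indicator hRm]
    _ ≤ (1 / (4 * h)) * ((4 + 2 * K) * h) + 8 * (1 + K) * Real.sqrt J + ρ8 * ∫ x, ‖u x‖ := by
        gcongr
    _ = (1 + K / 2) + 8 * (1 + K) * Real.sqrt J + ρ8 * ∫ x, ‖u x‖ := by
        field_simp
        ring
    _ ≤ (1 + K) + 8 * (1 + K) * Real.sqrt J + ρ8 * ∫ x, ‖u x‖ := by linarith
/-! ## Prime jumps -/

/-- **A prime jump.** If `χ ∈ [0, 1]` equals `1` at depth `a − |x| ≥ 2h`, `|u| ≤ K_A`, and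
`f ≥ |u|` on the layer of depth `< 2h` (`f ≥ 0` integrable), then for every shift `s`,
`∫ (χ(x+s) − χ(x))² |u(x+s)| |u(x)| dx ≤ 2 K_A ∫ f`: a non-zero integrand has one end in the
layer (else `χ = 1` at both ends), bounded by `f`, and the other end is `≤ K_A`. -/
theorem stub_commutatorBound_prime_le {u : ℝ → ℂ} {χ f : ℝ → ℝ} {a h KA : ℝ}
    (hχ01 : ∀ x, 0 ≤ χ x ∧ χ x ≤ 1) (hχ1 : ∀ x, |x| ≤ a - 2 * h → χ x = 1)
    (hbd : ∀ x, ‖u x‖ ≤ KA) (hf0 : ∀ x, 0 ≤ f x) (hf : ∀ x, a - |x| < 2 * h → ‖u x‖ ≤ f x)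
    (hfi : Integrable f) (s : ℝ) :
    ∫ x, (χ (x + s) - χ x) ^ 2 * (‖u (x + s)‖ * ‖u x‖) ≤ 2 * KA * ∫ x, f x := by
  have hKA : 0 ≤ KA := (norm_nonneg _).trans (hbd 0)
  have hpt : ∀ x, (χ (x + s) - χ x) ^ 2 * (‖u (x + s)‖ * ‖u x‖) ≤ KA * f x + KA * f (x + s) := by
    intro x
    have hsq : (χ (x + s) - χ x) ^ 2 ≤ 1 := by
      have h1 := hχ01 x
      have h2 := hχ01 (x + s)
      have hab : |χ (x + s) - χ x| ≤ 1 := abs_sub_le_iff.2 ⟨by linarith, by linarith⟩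
      calc (χ (x + s) - χ x) ^ 2 = |χ (x + s) - χ x| ^ 2 := (sq_abs _).symm
        _ ≤ 1 ^ 2 := pow_le_pow_left₀ (abs_nonneg _) hab 2
        _ = 1 := one_pow 2
    have hprod : 0 ≤ ‖u (x + s)‖ * ‖u x‖ := by positivity
    have h1 : (χ (x + s) - χ x) ^ 2 * (‖u (x + s)‖ * ‖u x‖) ≤ ‖u (x + s)‖ * ‖u x‖ := by
      calc _ ≤ 1 * (‖u (x + s)‖ * ‖u x‖) := mul_le_mul_of_nonneg_right hsq hprod
        _ = _ := one_mul _
    have hA : 0 ≤ KA * f x := mul_nonneg hKA (hf0 _)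
    have hB : 0 ≤ KA * f (x + s) := mul_nonneg hKA (hf0 _)
    by_cases hx : a - |x| < 2 * h
    · calc _ ≤ ‖u (x + s)‖ * ‖u x‖ := h1
        _ ≤ KA * f x := mul_le_mul (hbd _) (hf x hx) (norm_nonneg _) hKA
        _ ≤ KA * f x + KA * f (x + s) := le_add_of_nonneg_right hB
    · by_cases hy : a - |x + s| < 2 * h
      · calc _ ≤ ‖u (x + s)‖ * ‖u x‖ := h1
          _ = ‖u x‖ * ‖u (x + s)‖ := mul_comm _ _
          _ ≤ KA * f (x + s) := mul_le_mul (hbd _) (hf _ hy) (norm_nonneg _) hKA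
          _ ≤ KA * f x + KA * f (x + s) := le_add_of_nonneg_left hA
      · rw [hχ1 x (by linarith [not_lt.1 hx]), hχ1 (x + s) (by linarith [not_lt.1 hy]), sub_self]
        simp only [ne_eq, OfNat.ofNat_ne_zero, not_false_eq_true, zero_pow, zero_mul]
        exact add_nonneg hA hB
  have hfs : Integrable (fun x ↦ f (x + s)) := hfi.comp_add_right s
  have hA : Integrable (fun x ↦ KA * f x) := hfi.const_mul KA
  have hB : Integrable (fun x ↦ KA * f (x + s)) := hfs.const_mul KA
  calc ∫ x, (χ (x + s) - χ x) ^ 2 * (‖u (x + s)‖ * ‖u x‖)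
      ≤ ∫ x, (KA * f x + KA * f (x + s)) :=
        integral_mono_of_nonneg (Eventually.of_forall fun x ↦ by positivity) (hA.add hB)
          (Eventually.of_forall hpt)
    _ = KA * (∫ x, f x) + KA * ∫ x, f (x + s) := by
        rw [integral_add hA hB, integral_const_mul, integral_const_mul]
    _ = 2 * KA * ∫ x, f x := by
        rw [integral_add_right_eq_self f s]
        ring

/-! ## Pole pairings -/

/-- **A cut pole pairing.** If `|θ| ≤ 1` vanishes at depth `a − |x| ≥ 2h`, `u = 0` off `[-a, a]`,
`f ≥ |u|` on the layer of depth `< 2h` (`f ≥ 0` integrable) and `|w| ≤ M` on `[-a, a]`, then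
`|∫ θ u w| ≤ M ∫ f`. -/
theorem stub_commutatorBound_pole_le {u : ℝ → ℂ} {θ f w : ℝ → ℝ} {a h M : ℝ}
    (hu0 : ∀ x, x ∉ Icc (-a) a → u x = 0) (hθ : ∀ x, |θ x| ≤ 1)
    (hθ0 : ∀ x, |x| ≤ a - 2 * h → θ x = 0) (hf0 : ∀ x, 0 ≤ f x)
    (hf : ∀ x, a - |x| < 2 * h → ‖u x‖ ≤ f x) (hfi : Integrable f) (hM : 0 ≤ M)
    (hw : ∀ x, |x| ≤ a → |w x| ≤ M) :
    ‖∫ t, (θ t : ℂ) * u t * (w t : ℂ)‖ ≤ M * ∫ t, f t := by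
  rw [← integral_const_mul]
  refine norm_integral_le_of_norm_le (hfi.const_mul M) (Eventually.of_forall fun t ↦ ?_)
  rw [norm_mul, norm_mul, Complex.norm_real, Complex.norm_real, Real.norm_eq_abs,
    Real.norm_eq_abs]
  have hMf : 0 ≤ M * f t := mul_nonneg hM (hf0 t)
  by_cases hut : u t = 0
  · rw [hut, norm_zero, mul_zero, zero_mul]
    exact hMf
  have htI : t ∈ Icc (-a) a := by
    by_contra hc
    exact hut (hu0 t hc)
  have hta : |t| ≤ a := abs_le.2 ⟨htI.1, htI.2⟩
  by_cases hdeep : |t| ≤ a - 2 * h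
  · rw [hθ0 t hdeep, abs_zero, zero_mul, zero_mul]
    exact hMf
  · have hlay : a - |t| < 2 * h := by linarith [not_le.1 hdeep]
    calc |θ t| * ‖u t‖ * |w t| ≤ 1 * f t * M :=
          mul_le_mul (mul_le_mul (hθ t) (hf t hlay) (norm_nonneg _) zero_le_one) (hw t hta)
            (abs_nonneg _) (mul_nonneg zero_le_one (hf0 t))
      _ = M * f t := by ring

/-- **An uncut pole pairing**: `|∫ u w| ≤ M ∫ |u|` if `|w| ≤ M` on `[-a, a]` and `u = 0` off
`[-a, a]`. -/
theorem stub_commutatorBound_pairing_le {u : ℝ → ℂ} {w : ℝ → ℝ} {a M : ℝ}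
    (hu0 : ∀ x, x ∉ Icc (-a) a → u x = 0) (hui : Integrable u)
    (hw : ∀ x, |x| ≤ a → |w x| ≤ M) :
    ‖∫ t, u t * (w t : ℂ)‖ ≤ M * ∫ t, ‖u t‖ := by
  rw [← integral_const_mul]
  refine norm_integral_le_of_norm_le (hui.norm.const_mul M) (Eventually.of_forall fun t ↦ ?_)
  rw [norm_mul, Complex.norm_real, Real.norm_eq_abs]
  by_cases hut : u t = 0
  · rw [hut, norm_zero, zero_mul, mul_zero]
  have htI : t ∈ Icc (-a) a := by
    by_contra hc
    exact hut (hu0 t hc)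
  rw [mul_comm]
  exact mul_le_mul_of_nonneg_right (hw t (abs_le.2 ⟨htI.1, htI.2⟩)) (norm_nonneg _)

/-- `|cosh(t/2)| ≤ cosh(A/2)` and `|sinh(t/2)| ≤ cosh(A/2)` for `|t| ≤ a ≤ A`. -/
theorem stub_commutatorBound_cosh_sinh_le :
    ∀ {a A t : ℝ}, a ≤ A → |t| ≤ a →
      |Real.cosh (t / 2)| ≤ Real.cosh (A / 2) ∧ |Real.sinh (t / 2)| ≤ Real.cosh (A / 2) := by
  intro a A t haA ht
  have hc : Real.cosh (t / 2) ≤ Real.cosh (A / 2) := by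
    rw [Real.cosh_le_cosh, abs_div, abs_div, abs_two]
    have : |A| = A := abs_of_nonneg (by linarith [abs_nonneg t])
    rw [this]
    linarith
  refine ⟨by rwa [abs_of_pos (Real.cosh_pos _)], ?_⟩
  rw [Real.abs_sinh]
  calc Real.sinh |t / 2| ≤ Real.cosh |t / 2| := (Real.sinh_lt_cosh _).le
    _ = Real.cosh (t / 2) := Real.cosh_abs _
    _ ≤ Real.cosh (A / 2) := hc

/-! ## Mass of the cut state -/

/-- **Mass of the cut state**: `∫ |χ u|² ≥ ∫ |u|² − ∫_{a − 2h < |x|} |u|²` when `χ = 1` at depth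
`≥ 2h` (pointwise `|χ u|² ≥ |u|² − |u|² 1_{layer}`). -/
theorem stub_commutatorBound_mass_ge {u : ℝ → ℂ} {χ : ℝ → ℝ} {a h : ℝ}
    (husm : AEStronglyMeasurable u) (hu2 : Integrable fun x ↦ ‖u x‖ ^ 2)
    (hχc : Continuous χ) (hχ01 : ∀ x, 0 ≤ χ x ∧ χ x ≤ 1)
    (hχ1 : ∀ x, |x| ≤ a - 2 * h → χ x = 1) :
    (∫ x, ‖u x‖ ^ 2) - ∫ x in {x | a - 2 * h < |x|}, ‖u x‖ ^ 2 ≤ ∫ x, ‖(χ x : ℂ) * u x‖ ^ 2 := by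
  set L := {x : ℝ | a - 2 * h < |x|} with hL
  have hLm : MeasurableSet L := stub_commutatorBound_measurableSet_layer a _
  have hpt : ∀ x, ‖u x‖ ^ 2 - L.indicator (fun x ↦ ‖u x‖ ^ 2) x ≤ ‖(χ x : ℂ) * u x‖ ^ 2 := by
    intro x
    by_cases hx : x ∈ L
    · rw [indicator_of_mem hx, sub_self]
      positivity
    · have hx' : |x| ≤ a - 2 * h := by
        simp only [hL, mem_setOf_eq, not_lt] at hx
        exact hx
      rw [indicator_of_notMem hx, sub_zero, hχ1 x hx']
      simp
  have hint : Integrable fun x ↦ ‖(χ x : ℂ) * u x‖ ^ 2 := by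
    refine hu2.mono' ?_ (Eventually.of_forall fun x ↦ ?_)
    · exact (((Complex.continuous_ofReal.comp hχc).aestronglyMeasurable.mul husm).norm.pow 2)
    · rw [Real.norm_of_nonneg (by positivity), norm_mul, mul_pow, Complex.norm_real,
        Real.norm_eq_abs]
      have h1 : |χ x| ≤ 1 := abs_le.2 ⟨by linarith [(hχ01 x).1], (hχ01 x).2⟩
      have h2 : |χ x| ^ 2 ≤ 1 := by
        calc |χ x| ^ 2 ≤ 1 ^ 2 := pow_le_pow_left₀ (abs_nonneg _) h1 2
          _ = 1 := one_pow 2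
      calc |χ x| ^ 2 * ‖u x‖ ^ 2 ≤ 1 * ‖u x‖ ^ 2 :=
            mul_le_mul_of_nonneg_right h2 (by positivity)
        _ = ‖u x‖ ^ 2 := one_mul _
  have hLi : Integrable (L.indicator fun x ↦ ‖u x‖ ^ 2) := hu2.indicator hLm
  calc (∫ x, ‖u x‖ ^ 2) - ∫ x in L, ‖u x‖ ^ 2
      = ∫ x, (‖u x‖ ^ 2 - L.indicator (fun x ↦ ‖u x‖ ^ 2) x) := by
        rw [integral_sub hu2 hLi, integral_indicator hLm]
    _ ≤ ∫ x, ‖(χ x : ℂ) * u x‖ ^ 2 := integral_mono (hu2.sub hLi) hint hpt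

/-! ## The layer mass -/

/-- **The layer mass.** Under the edge-mass law (`0 < r ≤ d₀ ≤ 1/4`), for `J ≥ 1` with
`2^J ≤ 1/(2h)` and `2h ≤ d₀`: `∫_{a − 2h < |x|} |u| ≤ 2 (1 + K) h / √J`
(AM–GM with `λ = 1/√J` on a set of measure `≤ 4h`, and `log(1/(2h)) ≥ J log 2 ≥ J/2`). -/
theorem stub_commutatorBound_layer_le {u : ℝ → ℂ} {a d₀ K h : ℝ}
    (hu2 : Integrable fun x ↦ ‖u x‖ ^ 2) (hK : 0 ≤ K)
    (hB : ∀ r, 0 < r → r ≤ d₀ → ∫ x in {x | a - r < |x|}, ‖u x‖ ^ 2 ≤ K * r / Real.log (1 / r))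
    (hu0 : ∀ x, x ∉ Icc (-a) a → u x = 0) (hh : 0 < h) (h2d : 2 * h ≤ d₀) {J : ℕ} (hJ1 : 1 ≤ J)
    (hJ : (2 : ℝ) ^ J ≤ 1 / (2 * h)) :
    ∫ x in {x | a - 2 * h < |x|}, ‖u x‖ ≤ 2 * (1 + K) * h / Real.sqrt J := by
  set L := {x : ℝ | a - 2 * h < |x|} with hL
  have hLm : MeasurableSet L := stub_commutatorBound_measurableSet_layer a _
  have hJpos : (0 : ℝ) < J := by exact_mod_cast hJ1
  set σ := Real.sqrt (J : ℝ) with hσ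
  have hσpos : 0 < σ := Real.sqrt_pos.2 hJpos
  have hσ2 : σ ^ 2 = J := Real.sq_sqrt hJpos.le
  -- `log(1/(2h)) ≥ J log 2 ≥ J / 2`
  have hl2 := Real.log_two_gt_d9
  have hlog : (J : ℝ) / 2 ≤ Real.log (1 / (2 * h)) := by
    have h1 : (J : ℝ) * Real.log 2 ≤ Real.log (1 / (2 * h)) := by
      rw [← Real.log_pow]
      exact Real.log_le_log (by positivity) hJ
    nlinarith
  have hlogpos : 0 < Real.log (1 / (2 * h)) := by linarith
  have hmass : ∫ x in L, ‖u x‖ ^ 2 ≤ 2 * K * (2 * h) / J := by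
    calc ∫ x in L, ‖u x‖ ^ 2 ≤ K * (2 * h) / Real.log (1 / (2 * h)) := hB _ (by positivity) h2d
      _ ≤ K * (2 * h) / ((J : ℝ) / 2) := div_le_div_of_nonneg_left (by positivity) (by positivity) hlog
      _ = 2 * K * (2 * h) / J := by
          field_simp
  have hT := stub_commutatorBound_setIntegral_norm_le (u := u) hLm
    (stub_commutatorBound_measurableSet_shell a 0 (2 * h))
    (stub_commutatorBound_volume_shell_ne_top a 0 (2 * h)) (fun x hx hux ↦ ?_) hu2.integrableOn
    (inv_pos.2 hσpos) (S := L)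
  · have hvol := stub_commutatorBound_volume_real_shell_le a 0 (2 * h)
    simp only [sub_zero] at hvol hT
    rw [max_eq_left (by positivity)] at hvol
    calc ∫ x in L, ‖u x‖
        ≤ (σ⁻¹ * volume.real {x : ℝ | a - 2 * h < |x| ∧ |x| ≤ a} + (∫ x in L, ‖u x‖ ^ 2) / σ⁻¹) / 2 :=
          hT
      _ ≤ (σ⁻¹ * (2 * (2 * h)) + (2 * K * (2 * h) / J) / σ⁻¹) / 2 := by gcongr
      _ = 2 * (1 + K) * h / σ := by
          rw [← hσ2]
          field_simp
  · have hxI : x ∈ Icc (-a) a := by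
      by_contra hc
      exact hux (hu0 x hc)
    exact ⟨hx, by rw [sub_zero]; exact abs_le.2 ⟨hxI.1, hxI.2⟩⟩

end Summit.RiemannHypothesis.RiemannHypothesis.Theorems.WeilWindowFlowWindowLipschitz

end
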